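import Literature.NumberTheory.Automorphic.LanglandsTunnellModThree
import Literature.NumberTheory.Automorphic.CDTTheorem712
import Literature.NumberTheory.EllipticCurves.NewformGaloisRepResidualOfThm61Proofs
import HarnessLib

/-!
# STUB-IDEAS `stub_modThree` — ideator k = 2, GEN 3, HOME FAMILY 2 = RESHAPE

Typing aid for `STUB-IDEAS-stub_modThree-2.md` (gen 3).  Crux `FreyModularity`
(stmt-ABC-11340), skeleton `Cruxes/FreyModularity/Lines/Sketch.lean`, stub

  `stub_modThree : ∀ W [IsElliptic] (ρ : ModPGaloisRep ℚ (ZMod 3) 2),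
      W.IsTorsionGaloisRep 3 ρ → FramedRep.IsAbsolutelyIrreducible ρ → ρ.IsModular`.

Gen 3 RESHAPE = cut the stub along the restriction of `ρ̄` to INERTIA AT 2 (not along `4 ∣ N`,
not along the weight):
* reachable cell `¬ HasOrderFourInertiaAtTwo ρ̄` — the 3–2 switch (k = 3's Plan A) pushed to its
  natural boundary (`three_two_switch'`), any image of `ρ̄`;
* dihedral core `¬ Surjective ρ̄` — gen-2's weight-2 CM congruence, whose level clause H7 is
  REPLACED by the Brauer–Nesbitt–Chebotarev transport `isModular_of_congruence_cofinite` fed by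
  the tree's mod-`𝔓` newform representation
  (`DeligneSerre1974.exists_isGaloisRepOfNewform1Int_liftToGamma1_of_thm61`);
* octahedral core `Surjective ρ̄ ∧ HasOrderFourInertiaAtTwo ρ̄` — Tunnell, pointwise; closed under
  every mod-`ℓ` congruence (`hasOrderFourInertiaAtTwo_of_congr`, no-go).
Sorries are helper statements only; the assembly `stub_modThree_of_cells` is kernel-checked and has
the stub's signature verbatim (`SigStubModThree`).
-/

set_option autoImplicit false
set_option linter.dupNamespace false

noncomputable section

open scoped MatrixGroups NumberField Polynomial ModularForm
open Polynomial NumberField IsDedekindDomain CongruenceSubgroup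
open Literature.NumberTheory.GaloisRepresentations Literature.NumberTheory.Automorphic
open Literature.NumberTheory.Automorphic.BCDT
open Literature.NumberTheory.EllipticCurves Literature.NumberTheory.EllipticCurves.ModularForms
open Literature.NumberTheory.EllipticCurves.ModularForms.DeligneSerre1974
open Literature.NumberTheory.GaloisRepresentations.GL2F3Lift (lift redHom embHom)
open WeierstrassCurve

namespace Summit.ABC.ABC.Cruxes.FreyModularity.Sketch.StubIdeasModThreeK2G3

/-- The registered stub's signature, verbatim. -/
abbrev SigStubModThree : Prop :=
  ∀ (W : WeierstrassCurve ℚ) [W.IsElliptic] (ρ : ModPGaloisRep ℚ (ZMod 3) 2),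
    W.IsTorsionGaloisRep 3 ρ → FramedRep.IsAbsolutelyIrreducible ρ → ρ.IsModular

/-- The finite place `2` of `ℚ`. -/
def placeTwo : HeightOneSpectrum (𝓞 ℚ) := Rat.HeightOneSpectrum.primesEquiv.symm ⟨2, Nat.prime_two⟩

/-- **The cut.** `ρ̄(I₂)` contains an element of order `4` (equivalently, since the possible inertia
images in `GL₂(𝔽₃)` are `1, C₂, C₃, C₆, ±U` (reducible) or `C₄, Q₈, SL₂(𝔽₃)`: `ρ̄|_{I₂}` is
irreducible; for `ρ̄ = E[3]`: `E` potentially supersingular at `2` with `4 ∣ |Φ₂|`, Diamond–Kramer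
Table 3: `G₁ ∈ {ℤ/4, 𝔔}`). -/
def HasOrderFourInertiaAtTwo (ρ : ModPGaloisRep ℚ (ZMod 3) 2) : Prop :=
  ∃ 𝔔 ∈ placeTwo.primesAbove, ∃ τ ∈ 𝔔.inertia (Field.absoluteGaloisGroup ℚ), orderOf (ρ τ) = 4

/-! ### Cell 1 (reachable): the 3–2 switch at its natural boundary -/

/-- Allen 2014, Corollary over `ℚ` — k = 3's named fact `allen_corollary_rat`, restated verbatim so
that this file is self-contained. [cite: Allen2014, Corollary] -/
def AllenCorollaryRat : Prop :=
  ∀ (W : WeierstrassCurve ℚ) [W.IsElliptic] [NeZero (W.conductorNorm ℤ)],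
    padicValRat 2 W.j ≤ 0 →
    (∀ x : ℚ, ¬ W.twoTorsionPolynomial.toPoly.IsRoot x) →
    ¬ IsSquare W.Δ →
    (W.Δ < 0 → ¬ IsSquare (W.Δ : ℚ_[2])) →
    BCDT.IsModular W

/-- **N2′ (L) — the 3–2 switch with the sharp hypothesis.**  k = 3's `three_two_switch` with
`¬ 4 ∣ N_E` replaced by `¬ HasOrderFourInertiaAtTwo ρ̄`: additionally covers additive `E` with
`Φ₂ ∈ {C₂, C₃, C₆}` and additive potentially multiplicative `E`.  Local input at `2`: every class in
`H¹(ℚ₂, 𝔽₃(χ̄₃)) = ℚ₂ˣ/ℚ₂ˣ³ ≅ ℤ/3` is a (twisted) Tate class, so a `D₂`-reducible `ρ̄|_{D₂}` is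
`2`-adically a pencil point with `v₂(j) < 0`; `Φ₂ ⊆ {±1}` classes are twists of good curves. -/
def three_two_switch' : Prop :=
  ∀ (W : WeierstrassCurve ℚ) [W.IsElliptic] (ρ : ModPGaloisRep ℚ (ZMod 3) 2),
    W.IsTorsionGaloisRep 3 ρ → ¬ HasOrderFourInertiaAtTwo ρ →
    ∃ (W'' : WeierstrassCurve ℚ) (_ : W''.IsElliptic),
      W''.IsTorsionGaloisRep 3 ρ ∧ padicValRat 2 W''.j ≤ 0 ∧
      (∀ x : ℚ, ¬ W''.twoTorsionPolynomial.toPoly.IsRoot x) ∧ ¬ IsSquare W''.Δ ∧ 0 < W''.Δ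

/-- **R1 (XS, proved): the reachable cell is modular, for ANY image of `ρ̄`** (dihedral included;
no irreducibility used): `BCDT.IsModular E'' ⇒ ρ̄.IsModular` by the tree's
`IsModular.isModular_of_isTorsionGaloisRep''`. -/
theorem isModular_of_not_hasOrderFour (hA : AllenCorollaryRat) (hS : three_two_switch') :
    ∀ (W : WeierstrassCurve ℚ) [W.IsElliptic] (ρ : ModPGaloisRep ℚ (ZMod 3) 2),
      W.IsTorsionGaloisRep 3 ρ → ¬ HasOrderFourInertiaAtTwo ρ → ρ.IsModular := by
  intro W _ ρ hρ h4
  obtain ⟨W'', hW'', hρ'', hj, h2t, hsq, hpos⟩ := hS W ρ hρ h4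
  haveI := hW''
  haveI : NeZero (W''.conductorNorm ℤ) := ⟨(conductorNorm_pos_holds W'').ne'⟩
  haveI : Fact (Nat.Prime 3) := ⟨Nat.prime_three⟩
  have hmod : BCDT.IsModular W'' := hA W'' hj h2t hsq fun hneg ↦ absurd hpos (not_lt.mpr hneg.le)
  exact hmod.isModular_of_isTorsionGaloisRep'' hρ''

/-! ### No-go lemmas (why the core cannot be reached by ANY switching chain) -/

/-- **NG1 (S): order-4 inertia at 2 is a congruence invariant.**  If `E[ℓ] ≅ E'[ℓ]` for a prime
`ℓ ≥ 3` then `ρ̄_{E,3}(I₂) ∋` order 4 `⇒ ρ̄_{E',3}(I₂) ∋` order 4: order 4 forces potentially good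
reduction, `Φ₂ ↪ Aut E[ℓ]` is injective for `ℓ ≥ 3` and the abstract group `Φ₂ = ρ̄_{E,ℓ}(I₂)` is
independent of `ℓ` (Serre–Tate; Diamond–Kramer: "the kernel of `ρ̄_{E,ℓ'}` restricted to `I_K` is
independent of `ℓ`"), while a semistable or potentially multiplicative `E'` has inertia of exponent
dividing `2ℓ`. [cite: corpus book:cornell1997-modular-forms-fermats-last-theorem, Appendix by Diamond–Kramer, PDF p. 579 and Table 3 p. 585] -/
theorem hasOrderFourInertiaAtTwo_of_congr {ℓ : ℕ} [Fact ℓ.Prime] (hℓ : 3 ≤ ℓ)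
    (W W' : WeierstrassCurve ℚ) [W.IsElliptic] [W'.IsElliptic]
    (ρℓ : ModPGaloisRep ℚ (ZMod ℓ) 2) (hW : W.IsTorsionGaloisRep ℓ ρℓ)
    (hW' : W'.IsTorsionGaloisRep ℓ ρℓ)
    (ρ ρ' : ModPGaloisRep ℚ (ZMod 3) 2) (h3 : W.IsTorsionGaloisRep 3 ρ)
    (h3' : W'.IsTorsionGaloisRep 3 ρ') :
    HasOrderFourInertiaAtTwo ρ → HasOrderFourInertiaAtTwo ρ' := by
  sorry

/-- **NG2 (S): the core is never nearly ordinary at 2** — order-4 inertia `⇒ v₂(j) > 0`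
(potentially multiplicative: inertia acts through `±` unipotents, orders `∣ 6`; potentially
ordinary: `Φ₂ ↪ Aut` of an ordinary curve in characteristic 2, order `≤ 2`).  With NG1: no member of
any mod-`ℓ` congruence chain from the core satisfies Allen's hypothesis (1). -/
theorem padicValRat_j_pos_of_hasOrderFour (W : WeierstrassCurve ℚ) [W.IsElliptic]
    (ρ : ModPGaloisRep ℚ (ZMod 3) 2) (hρ : W.IsTorsionGaloisRep 3 ρ)
    (h4 : HasOrderFourInertiaAtTwo ρ) : 0 < padicValRat 2 W.j := by
  sorry

/-! ### Cell 2 (dihedral core): weight-2 CM congruence + Brauer–Nesbitt–Chebotarev transport -/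

/-- **L1 (M) — congruence off a FINITE set + a genuine mod-`𝔓` newform representation ⇒ modular.**
Replaces gen-2's H1 (clause at ALL `p ∤ 3N`) + H7 (exact level).  Here `κ` is any discrete field
receiving `π : ℤ̄ → κ` with `π ∘ embInt` killing `𝔭 = (1+√-2)` (so `κ ⊇ 𝔽₃`; in the assembly
`κ = ℤ̄/𝔓`, `π = mk 𝔓`, exactly as in `isModular_of_…_langlands_tunnell`, L482–503).  Proof: with
`j : 𝔽₃ → κ` induced by `π ∘ embInt` and `ρ̄^κ = baseChange j ρ̄`, the pair `(ρ̄^κ, ρg)` has open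
kernel; Chebotarev, existence form (`FramedGaloisRep.infinite_setOf_isArithFrobAt_apply_eq_of_isOpen_ker`
with the pair trick `exists_monoidHom_prod_entries` — verbatim the proof of
`FramedGaloisRep.charpoly_eq_of_isResidualRepOf_of_congruent`) gives equal characteristic
polynomials on all of `Γ_ℚ` (at a Frobenius `Φ` at `v ∉ S` both equal `π(P_v)`: the two integral
lifts `P_v`, `θ(P'_v)` of the Hecke polynomial agree in `ℤ̄[X] ⊂ ℂ[X]`, and
`charpoly(ρ̄^κ Φ) = π(embInt(charpoly Ψ̃(ρ̄ Φ)))` by `map_redHom_charpoly_lift`); Brauer–Nesbitt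
(`brauerNesbitt_holds`; `ρ̄^κ` irreducible from `habs`, `ρg` semisimple) ⇒ `ρ̄^κ ≃ ρg` ⇒
`IsGaloisRepOfNewform1Int.of_equiv` transports unramifiedness and the Frobenius clause at EVERY
`p ∤ 3N` ⇒ `IsModular` with `K = κ`, weight `w`.  No unramifiedness of `ρ̄` is assumed. -/
theorem isModular_of_congruence_cofinite (ρ : ModPGaloisRep ℚ (ZMod 3) 2)
    (habs : FramedRep.IsAbsolutelyIrreducible ρ)
    {κ : Type} [Field κ] [TopologicalSpace κ] [DiscreteTopology κ]
    (π : integralClosure ℤ ℂ →+* κ) (hπ : RingHom.ker redHom ≤ (RingHom.ker π).comap embInt)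
    (N : ℕ) [NeZero N] (w : ℤ) (hw : 1 ≤ w) (f : CuspForm (Gamma1 N) w) (hnew : IsNewform1 f)
    (S : Set (HeightOneSpectrum (𝓞 ℚ))) (hS : S.Finite)
    (hcong : ∀ v ∉ S, ∃ P : (integralClosure ℤ ℂ)[X],
        P.map (algebraMap (integralClosure ℤ ℂ) ℂ) =
          (heckePolynomial f (Rat.HeightOneSpectrum.primesEquiv v : Nat.Primes)).map
            (algebraMap (coeffCharField f) ℂ) ∧
        ∀ 𝔔 ∈ v.primesAbove, ∀ τ : Field.absoluteGaloisGroup ℚ, IsArithFrobAt (𝓞 ℚ) τ 𝔔 →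
          ((lift (ρ τ)).charpoly.map embInt).map π = P.map π)
    (θ : coeffCharIntegers f →+* integralClosure ℤ ℂ)
    (hθ : ∀ x, ((θ x : integralClosure ℤ ℂ) : ℂ) =
      algebraMap (coeffCharField f) ℂ (algebraMap (coeffCharIntegers f) (coeffCharField f) x))
    (ρg : FramedGaloisRep ℚ κ 2) (hss : ρg.toGaloisRep.IsSemisimple)
    (hg : IsGaloisRepOfNewform1Int f (π.comp θ) {q | q ∣ N * 3} ρg) :
    ρ.IsModular := by
  sorry

/-- **L2 = a TREE THEOREM, cited not restated**:
`DeligneSerre1974.exists_isGaloisRepOfNewform1Int_liftToGamma1_of_thm61 (h61) (hk : 2 ≤ k)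
(hg : IsNewform0 g) 3 (ι : 𝓞_{g} →+* κ) : ∃ ρg, IsGaloisRepOfNewform1Int (liftToGamma1 M k g) ι
{p ∣ M*3} ρg ∧ ρg.toGaloisRep.IsSemisimple` for any discrete field `κ` with `CharP κ 3`
(NewformGaloisRepResidualOfThm61Proofs.lean:300).  This `example` only pins the instance shape. -/
example (h61 : thm61_exists_adicGaloisRep) {M : ℕ} [NeZero M] {k : ℤ} (hk : 2 ≤ k)
    {g : CuspForm (Gamma0 M) k} (hg : IsNewform0 g)
    {κ : Type} [Field κ] [CharP κ 3] [TopologicalSpace κ] [DiscreteTopology κ]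
    (ι : coeffCharIntegers (liftToGamma1 M k g) →+* κ) :
    ∃ ρg : FramedGaloisRep ℚ κ 2,
      IsGaloisRepOfNewform1Int (liftToGamma1 M k g) ι {p | p ∣ M * 3} ρg ∧
        ρg.toGaloisRep.IsSemisimple := by
  haveI : Fact (Nat.Prime 3) := ⟨Nat.prime_three⟩
  exact exists_isGaloisRepOfNewform1Int_liftToGamma1_of_thm61 h61 hk hg 3 ι

/-- **D (assembled elsewhere; M of glue) — the dihedral core.**  `¬ Surjective ρ̄` ⇒ Cartan
normaliser, imaginary quadratic `M` (gen-2 H3) ⇒ Hecke data `(𝔣, χ)` WITHOUT `IsConductor`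
(gen-2 H4) ⇒ `Ψ₀` (H5) ⇒ CM newform `g ∈ S₂(Γ₀(N))` with the congruence off `S = primes(3·D·N𝔣)`
(H6, PROVED engine `Ribet1977_cmNewform_gamma0_of_isGrossencharakter_holds`) ⇒ L2 (tree) at
`κ = ℤ̄/𝔓` ⇒ `isModular_of_congruence_cofinite`.  Debt: `thm61` only (no exact level, no weight one). -/
theorem isModular_of_not_surjective (h61 : thm61_exists_adicGaloisRep) :
    ∀ (W : WeierstrassCurve ℚ) [W.IsElliptic] (ρ : ModPGaloisRep ℚ (ZMod 3) 2),
      W.IsTorsionGaloisRep 3 ρ → FramedRep.IsAbsolutelyIrreducible ρ →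
      ¬ Function.Surjective ρ → ρ.IsModular := by
  sorry

/-! ### Cell 3 (octahedral core): Tunnell, pointwise -/

/-- Oddness from the Weil pairing (gen-2 H2, proved). -/
theorem isOdd_of_isTorsionGaloisRep (W : WeierstrassCurve ℚ) [W.IsElliptic]
    (ρ : ModPGaloisRep ℚ (ZMod 3) 2) (hρ : W.IsTorsionGaloisRep 3 ρ) : FramedGaloisRep.IsOdd ρ := by
  haveI : NeZero ((3 : ℕ) : ℚ) := ⟨by norm_num⟩
  intro φ c hc
  rw [W.det_eq_modPCyclotomicCharacter_of_isTorsionGaloisRep_holds 3 ρ hρ c]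
  ext
  rw [modPCyclotomicCharacterZMod_eq_modNCyclotomicCharacter,
    modNCyclotomicCharacter_of_isComplexConjugation hc, Units.val_neg, Units.val_one]

/-- The core cell as a proposition: surjective `ρ̄` with order-4 inertia at `2`. -/
def CoreCell : Prop :=
  ∀ (W : WeierstrassCurve ℚ) [W.IsElliptic] (ρ : ModPGaloisRep ℚ (ZMod 3) 2),
    W.IsTorsionGaloisRep 3 ρ → FramedRep.IsAbsolutelyIrreducible ρ →
    Function.Surjective ρ → HasOrderFourInertiaAtTwo ρ → ρ.IsModular

/-- **H8s — pointwise descent, ALREADY PROVED by k = 1** (`…Sketch.StubModThreeIdeasK1G2.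
isModular_of_langlands_tunnell_at`, `STUB_IDEAS_stub_modThree_1.lean:81`, 0 sorries, same binders);
restated here only because crux-dir files are not importable on the farm — cite k = 1's by name. -/
theorem isModular_of_langlands_tunnell_at (ρ : ModPGaloisRep ℚ (ZMod 3) 2)
    (hLT : langlands_tunnell (modThreeLift ρ)) (habs : FramedRep.IsAbsolutelyIrreducible ρ)
    (hodd : FramedGaloisRep.IsOdd ρ) : ρ.IsModular := by
  sorry

/-- The core from Langlands–Tunnell restricted to the core's own `σ`'s (status quo on the cell). -/
theorem coreCell_of_langlands_tunnell_at
    (hLT : ∀ ρ : ModPGaloisRep ℚ (ZMod 3) 2, Function.Surjective ρ → HasOrderFourInertiaAtTwo ρ →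
      langlands_tunnell (modThreeLift ρ)) : CoreCell :=
  fun W _ ρ hρ habs hs h4 ↦
    isModular_of_langlands_tunnell_at ρ (hLT ρ hs h4) habs (isOdd_of_isTorsionGaloisRep W ρ hρ)

/-- (Sanity: the unrestricted fact certainly gives the core.) -/
theorem coreCell_of_langlands_tunnell (hLT : ∀ σ : FramedArtinRep ℚ 2, langlands_tunnell σ) :
    CoreCell :=
  fun W _ ρ hρ habs _ _ ↦
    ModPGaloisRep.isModular_of_isAbsolutelyIrreducible_of_isOdd_of_langlands_tunnell hLT ρ habs
      (isOdd_of_isTorsionGaloisRep W ρ hρ)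

/-! ### Assembly — the stub's signature VERBATIM -/

/-- **Glue (XS, kernel-checked): the three cells cover the stub.** -/
theorem stub_modThree_of_cells (hA : AllenCorollaryRat) (hS : three_two_switch')
    (hD : ∀ (W : WeierstrassCurve ℚ) [W.IsElliptic] (ρ : ModPGaloisRep ℚ (ZMod 3) 2),
      W.IsTorsionGaloisRep 3 ρ → FramedRep.IsAbsolutelyIrreducible ρ →
      ¬ Function.Surjective ρ → ρ.IsModular)
    (hC : CoreCell) : SigStubModThree := by
  intro W _ ρ hρ habs
  by_cases h4 : HasOrderFourInertiaAtTwo ρ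
  · by_cases hs : Function.Surjective ρ
    · exact hC W ρ hρ habs hs h4
    · exact hD W ρ hρ habs hs
  · exact isModular_of_not_hasOrderFour hA hS W ρ hρ h4

/-- **The plan with its debts named**: Allen's corollary (N1), the sharp switch (N2′), Deligne's
`thm61` (dihedral core), Langlands–Tunnell only at surjective `ρ̄` with order-4 inertia at 2. -/
theorem stub_modThree_of_plan (hA : AllenCorollaryRat) (hS : three_two_switch')
    (h61 : thm61_exists_adicGaloisRep)
    (hLT : ∀ ρ : ModPGaloisRep ℚ (ZMod 3) 2, Function.Surjective ρ → HasOrderFourInertiaAtTwo ρ →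
      langlands_tunnell (modThreeLift ρ)) : SigStubModThree :=
  stub_modThree_of_cells hA hS (isModular_of_not_surjective h61) (coreCell_of_langlands_tunnell_at hLT)

end Summit.ABC.ABC.Cruxes.FreyModularity.Sketch.StubIdeasModThreeK2G3

end
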